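import Summits.BirchSwinnertonDyer.BirchSwinnertonDyer.Theorems.EdixhovenFibreFiveSevenStarredOptimalManinUnitFiveSevenCellsOfSL2NeronValuesBar
import Literature.NumberTheory.EllipticCurves.DualExpEllipticReciprocityLaw
import HarnessLib

/-!
# K★ `StarredOptimalManinUnitFiveSeven` from Kato's explicit reciprocity law [REC-tower] and the print-faithful P1

Crux K★ `stmt-BirchSwinnertonDyer-22226` (route EdixhovenFibreFiveSeven, line `kato_lever`, skeleton v6
`Cruxes/StarredOptimalManinUnitFiveSeven/Lines/kato_lever.lean`). CONDITIONAL closer (the item is NOT closed by this file; every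
hypothesis is a cite-only PUBLISHED fact consumed by name):

* ★ `starredOptimalManinUnitFiveSeven_of_reciprocityLaw_of_sl2NeronValuesBar : [REC-tower] → P1-bar → K★`, where
  [REC-tower] = `Literature.NumberTheory.EllipticCurves.tatePairingPoint_eq_trace_expStar_log_tower` (Kato, LNM 1553, Ch. II
  Thm. 1.4.1 (4) with Lemma 1.4.3–1.4.5 and §1.2.4: `⟨[η], κ(P)⟩ = Tr_{F/ℚ_p}(c · exp*_d(η) · log_ω P)` at the two levels of a
  tower with one constant; p700964) and P1-bar = `Kato2004.exists_member_sl2ZetaElement_neron_values_bar` (Kato 2004, the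
  `SL₂(ℤ)` zeta element's values in the Néron coordinate, print-faithful `χ̄`; p697548).

Compared with the v4/v5 closers (`…_of_expStarTower_of_sl2NeronValuesBar`, hypothesis hT₂ =
`PAdicHodge.exists_smul_range_expStarCoord_tower_iff_trace_log`), the Tate-duality half of hT₂ is no longer assumed: hT₂ follows
from [REC-tower] by `exists_smul_range_expStarCoord_tower_iff_trace_log_of_reciprocityLaw` (p700964: the assembly
`PAdicHodge.exists_smul_range_tower_of_reciprocity` fed with the tree's theorems [TD]
`exists_contOneCocycles_tatePairingPoint(Tower)_eq`, [N] `eq_zero_of_forall_trace_mul_padicLog_baseChange_eq_zero` (p687601),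
[ADD] `FormalGroupChart.padicLogPointFiniteExt_baseChange_add` (p700201) and the Weil tower
`WeierstrassCurve.exists_weilPairing_torsionMul_tower` (p700408)).

HONEST FRAMING: K★ stays OPEN ⟸ {P1-bar, [REC-tower]}, both XL formalisation targets (memos `Lines/kato-lever-hT2-programme.md`,
`Lines/kato-lever-K3-programme.md`); BSD is not proved by any of this.
-/

set_option linter.dupNamespace false

noncomputable section

open Literature.NumberTheory.EllipticCurves Literature.NumberTheory.EllipticCurves.Kato2004
  Literature.NumberTheory.PAdicHodge
  Summit.BirchSwinnertonDyer.BirchSwinnertonDyer.Theorems.StarredOptimalManinUnitFiveSevenCellsOfSL2NeronValuesBar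

namespace Summit.BirchSwinnertonDyer.BirchSwinnertonDyer.Theorems.StarredOptimalManinUnitFiveSevenOfReciprocityLaw

/-- **hT₂ along the line `kato_lever` from Kato's reciprocity law** (the in-skeleton derivation `expStarTower_of_stub` as a tree
theorem: `exists_smul_range_expStarCoord_tower_iff_trace_log_of_reciprocityLaw`). [cite: Kato1993LNM1553, Ch. II Thm. 1.4.1 (3)–(4) and §1.2.4]
[cite: BlochKato1990, Prop. 3.8 (p. 354), Example 3.11 (p. 361)] -/
theorem expStarTower_of_reciprocityLaw (hrec : tatePairingPoint_eq_trace_expStar_log_tower) :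
    exists_smul_range_expStarCoord_tower_iff_trace_log :=
  exists_smul_range_expStarCoord_tower_iff_trace_log_of_reciprocityLaw hrec

/-- ★ **K★ ⟸ {[REC-tower], P1-bar}, BY NAME**: Manin's `p`-part at the `X₀(N)`-optimal curve of starred additive type at
`p ∈ {5, 7}` (`Summit.…Theses.EdixhovenFibreFiveSeven.StarredOptimalManinUnitFiveSeven`) follows from Kato's explicit reciprocity law
for `V_pE` at two levels of a tower (`tatePairingPoint_eq_trace_expStar_log_tower`) and Kato's `SL₂(ℤ)` zeta-element values in the
Néron coordinate (`exists_member_sl2ZetaElement_neron_values_bar`) — the composition of skeleton v6: the F3 closer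
`starredOptimalManinUnitFiveSeven_of_expStarTower_of_sl2NeronValuesBar` ((G)-ordinary cells from the tree, supersingular cells from the
explicit-model de Rham capstone) fed with hT₂ := `expStarTower_of_reciprocityLaw hrec`. CONDITIONAL on two cite-only facts; not a
closing of the item. [cite: Kato1993LNM1553, Ch. II Thm. 1.4.1 (4), Lemma 1.4.3–1.4.5] [cite: Kato2004Asterisque, Thm. 6.6 (1) (p. 163), (8.1.3) (p. 180), Thm. 9.7 (p. 189)]
[cite: EdixhovenManin1991, Thm. 3] -/
theorem starredOptimalManinUnitFiveSeven_of_reciprocityLaw_of_sl2NeronValuesBar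
    (hrec : tatePairingPoint_eq_trace_expStar_log_tower) (hP1 : exists_member_sl2ZetaElement_neron_values_bar) :
    Summit.BirchSwinnertonDyer.BirchSwinnertonDyer.Theses.EdixhovenFibreFiveSeven.StarredOptimalManinUnitFiveSeven :=
  starredOptimalManinUnitFiveSeven_of_expStarTower_of_sl2NeronValuesBar (expStarTower_of_reciprocityLaw hrec) hP1

end Summit.BirchSwinnertonDyer.BirchSwinnertonDyer.Theorems.StarredOptimalManinUnitFiveSevenOfReciprocityLaw

end
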